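import Summits.CriticalPhenomena.PercolationContinuityZ3.Theorems.PercNearOneGluingNoHeavyQuantForestLawTreeBuilt
import Summits.CriticalPhenomena.PercolationContinuityZ3.Theorems.PercNearOneGluingNoHeavyQuantSDECPoint
import Summits.CriticalPhenomena.PercolationContinuityZ3.Theorems.PercNearOneGluingNoHeavyQuantFarTreeMeanLeOne
import HarnessLib

/-!
# QUANT lane R8, T-DEC — `LawDec.SDECConvClosed ⟹ Quant.TreeDEC` (the typed finite-layer conjecture, tight floor included):
# the reached-relay count of every rooted forest is GATE-STABLE DEC at every floor `0 < x < 1` below or AT its least marginal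

builds on p205010 (kernel theorem, internal audit signed; external expert review pending)

Support file (`--supports stmt-CriticalPhenomena-4575`), QUANT lane lead seat prim-quant-lead (gen 20), rung R8 of
`run/shared/lean/prim/quant/LADDER.md`.  Theorems only, no definitions, no sorries, standard axioms.  Part 3 of the bridge
(`…QuantForestLawTreeBuilt` = forest count laws are `LawDec.TreeBuilt` STRICTLY below the least marginal; `…QuantFarTreeRowOfTreeBuilt` =
`SDECConvClosed ⟹ FarTreeRow`).  census-2 g53 (DEC-CLOSURE-G53 §0 (4), `…QuantSDEC`/`…QuantSDECPoint`) asked: "if SDEC conv-closure survives,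
TYPE it and reduce `TreeDEC` + the FAR tree rows to it"; the FAR rows are part 2, `Quant.TreeDEC` is this file.  The TIGHT floor
(`1 − t` = the least marginal exactly, where `TreeBuilt`'s bases at floors `< 1` do not reach) is handled as census-2 suggested: run the
root-peeling induction of part 1 with the invariant `LawDec.SDEC` itself (bases `sdec_point` at floors `≤ 1`, steps `sdec_gate` and the
hypothesis `SDECConvClosed`), the non-strict floor hypothesis `x ≤ ∏_{P a} q`, and the degenerate sub-case "erased system with all
marginals 1" discharged by a point law (`real_count_eq_point_of_marginal_one`).

* `ForestLaw.law_eq_zero_of_lt / sum_law_eq_one / sum_mul_law_eq / floor_mul_card_le_sum` — the law facts of the count law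
  (`RootDecGate.*` of `…QuantFarTreeMeanLeOne` / `…FarTreeTAMP` with one structure).
* `ForestLaw.real_count_eq_point_of_marginal_one` — all marginals `1` ⟹ the law is `δ_{#A}`.
* `LawDec.decAt_point` (a point mass is DEC at every floor and layer), `LawDec.decAt_of_floor_nonpos` (every law is DEC at every layer at
  floors `≤ 0`: Lemma P's mean-exact decomposition, credit `= mean + lo`).
* **`ForestLaw.sdec_real_count` / `sdec_law`**: `SDECConvClosed →` for transitive comparable ancestor finsets, every relay set and every floor
  `0 < x < 1` with `x ≤ ∏_{y ∈ P a} q y` on `A`, the count law is `LawDec.SDEC x #A`.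
* **`Quant.treeDEC_of_sdecConvClosed : LawDec.SDECConvClosed → Quant.TreeDEC`** (floors `≤ 0` and `≥ 1` unconditionally; the hypothesis
  `E N ≤ 2j′` of `TreeDEC` is not even needed: SDEC gives every layer).  CONDITIONAL result; `SDECConvClosed` (exact LP 0 / ≈17 000 pairs)
  and `TreeDEC` remain OPEN.

[this work]; law-level class, SDEC and the closure conjecture: prim-quant-census-2 g53 (this lane); conditioning / block independence / product
measure [cite: Grimmett1999, §2.4; §2.2; §1.3 p. 10]; the gluing rows served [cite: KozmaNitzan2024, Conjecture 3 (p. 15)].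
-/

noncomputable section

namespace Summit.CriticalPhenomena.PercolationContinuityZ3.Theorems

namespace Quant

/-- the two-point law `{lo, hi; g}` (as in `…QuantLawDEC`) -/
local notation3 "TP[" lo ", " hi ", " g ", " h "]" =>
  (g : ℝ) * (if (h : ℕ) = (hi : ℕ) then (1 : ℝ) else 0) + (1 - (g : ℝ)) * (if (h : ℕ) = (lo : ℕ) then (1 : ℝ) else 0)

namespace LawDec

open Finset

/-- **A point mass `δ_M` is DEC at every floor and every layer**: one sure component `lo = hi = M`, self-sufficient since `T = M ≤ 2M`. [this work] -/
theorem decAt_point (x : ℝ) (j' M : ℕ) : DECAt x j' M (fun h => if h = M then (1 : ℝ) else 0) := by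
  have hmean : ∑ h ∈ Finset.range (M + 1), (h : ℝ) * (if h = M then (1 : ℝ) else 0) = M := by
    rw [Finset.sum_eq_single M]
    · simp
    · intro h _ hne; rw [if_neg hne, mul_zero]
    · intro hM; exact absurd (Finset.mem_range.2 (Nat.lt_succ_self M)) hM
  refine ⟨Unit, inferInstance, fun _ => 1, fun _ => 1, fun _ => M, fun _ => M, fun _ => zero_le_one, by simp,
    fun _ => ⟨zero_le_one, le_rfl⟩, fun _ => le_rfl, fun _ => le_rfl, fun h => ?_, fun _ _ => ?_⟩
  · simp only [Finset.univ_unique, Finset.sum_singleton, one_mul, sub_self, zero_mul, add_zero]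
  · refine Or.inl ⟨rfl, Or.inl ?_⟩
    rw [hmean]
    have : (0 : ℝ) ≤ M := Nat.cast_nonneg M
    linarith

/-- **At floors `x ≤ 0` every law is DEC at every layer**: Lemma P's mean-exact decomposition (`exists_twoPoint_decomposition_TA`) has
point components of mean `T` (so `T ≤ 2k`), pairs reaching above the layer with gate `≥ 0 ≥ x`, and pairs below the layer with credit
`2lo + (hi − lo)g = T + lo ≥ T`. [this work] -/
theorem decAt_of_floor_nonpos (M : ℕ) (μ : ℕ → ℝ) (hμ0 : ∀ h, 0 ≤ μ h) (hμM : ∀ h, M < h → μ h = 0)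
    (hμ1 : ∑ h ∈ Finset.range (M + 1), μ h = 1) (x : ℝ) (hx : x ≤ 0) (j' : ℕ) : DECAt x j' M μ := by
  have hT0 : 0 ≤ ∑ h ∈ Finset.range (M + 1), (h : ℝ) * μ h :=
    Finset.sum_nonneg fun h _ => mul_nonneg (Nat.cast_nonneg h) (hμ0 h)
  obtain ⟨lam, g, lo, hi, h0, h1, hg, hlohi, hhi, hμ, hgen⟩ :=
    exists_twoPoint_decomposition_TA M M le_rfl μ hμ0 hμM hμ1 x
      (fun h _ => (mul_nonpos_iff.2 (Or.inr ⟨hx, Nat.cast_nonneg h⟩)).trans hT0)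
  refine ⟨Fin (M + 1) × Fin (M + 1), inferInstance, lam, g, lo, hi, h0, h1, hg, hlohi, hhi, hμ, fun r hr => ?_⟩
  obtain ⟨-, -, hmeanr, -, -⟩ := hgen r hr
  rcases Nat.eq_or_lt_of_le (hlohi r) with heq | hlt
  · refine Or.inl ⟨heq, Or.inl ?_⟩
    rw [← hmeanr, ← heq, sub_self, zero_mul, add_zero]
    have : (0 : ℝ) ≤ lo r := Nat.cast_nonneg _
    linarith
  · by_cases hgi : j' + 1 ≤ hi r
    · exact Or.inr (Or.inl ⟨hlt, hgi, hx.trans (hg r).1⟩)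
    · refine Or.inr (Or.inr ⟨hlt, by omega, ?_⟩)
      rw [if_pos (hx.trans (hg r).1), ← hmeanr]
      have : (0 : ℝ) ≤ lo r := Nat.cast_nonneg _
      linarith

end LawDec

namespace ForestLaw

open Finset MeasureTheory
open Literature.Probability.LatticeModels
open Literature.Probability.Percolation
open scoped Classical

variable {E : Type*} [Fintype E]

/-- the number of relays of `A` reached in `ω` (all ancestral gates `P a` open) -/
local notation3 "Nc[" A ", " P ", " ω "]" =>
  ((A : Finset E).filter fun a => (((P : E → Finset E) a : Finset E) : Set E) ⊆ (ω : Set E)).card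

/-! ### Law facts of the count law (one structure) -/

omit [Fintype E] in
/-- the count law vanishes above `#A`. [this work] -/
theorem law_eq_zero_of_lt (q : E → unitInterval) (A : Finset E) (P : E → Finset E) (h : ℕ) (hh : A.card < h) :
    (prodBernoulli q).real {ω : Set E | Nc[A, P, ω] = h} = 0 := by
  have e := RootDecGate.real_Nk_eq_zero_of_lt q A P (fun _ : E => ()) () h
  simp only [Finset.filter_true] at e
  exact e hh

/-- the count law has mass `1`. [this work] -/
theorem sum_law_eq_one (q : E → unitInterval) (A : Finset E) (P : E → Finset E) :
    ∑ h ∈ Finset.range (A.card + 1), (prodBernoulli q).real {ω : Set E | Nc[A, P, ω] = h} = 1 := by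
  have e := RootDecGate.sum_real_Nk_eq_one q A P (fun _ : E => ()) ()
  simp only [Finset.filter_true] at e
  exact e

/-- the mean of the count law is the sum of the marginals. [this work] -/
theorem sum_mul_law_eq (q : E → unitInterval) (A : Finset E) (P : E → Finset E) :
    ∑ h ∈ Finset.range (A.card + 1), (h : ℝ) * (prodBernoulli q).real {ω : Set E | Nc[A, P, ω] = h} =
      ∑ a ∈ A, ∏ y ∈ P a, (q y : ℝ) := by
  have e := RootDecGate.sum_mul_real_Nk_eq q A P (fun _ : E => ()) ()
  simp only [Finset.filter_true] at e
  exact e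

omit [Fintype E] in
/-- top-affordability: a floor below every marginal times `#A` is at most the mean. [this work] -/
theorem floor_mul_card_le_sum (q : E → unitInterval) (A : Finset E) (P : E → Finset E) (x : ℝ)
    (hfloor : ∀ a ∈ A, x ≤ ∏ y ∈ P a, (q y : ℝ)) : x * (A.card : ℝ) ≤ ∑ a ∈ A, ∏ y ∈ P a, (q y : ℝ) := by
  have h := Finset.card_nsmul_le_sum A (fun a => ∏ y ∈ P a, (q y : ℝ)) x hfloor
  rw [nsmul_eq_mul] at h
  linarith

/-- **All marginals `1` ⟹ the count is surely `#A`** (every needed gate is sure). [this work] -/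
theorem real_count_eq_point_of_marginal_one (q : E → unitInterval) (A : Finset E) (P : E → Finset E)
    (h1 : ∀ a ∈ A, ∏ y ∈ P a, (q y : ℝ) = 1) (h : ℕ) :
    (prodBernoulli q).real {ω : Set E | Nc[A, P, ω] = h} = if h = A.card then 1 else 0 := by
  -- every needed gate is sure
  have hq1 : ∀ y ∈ A.biUnion P, (q y : ℝ) = 1 := by
    intro y hy
    obtain ⟨a, ha, hya⟩ := Finset.mem_biUnion.1 hy
    exact le_antisymm (q y).2.2 ((h1 a ha).symm.le.trans (prod_coe_le_apply q hya))
  -- the event "every needed gate open" has probability 1 and forces `N = #A`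
  have htop : (prodBernoulli q).real {ω : Set E | Nc[A, P, ω] = A.card} = 1 := by
    refine le_antisymm measureReal_le_one ?_
    have hsub : {ω : Set E | ((A.biUnion P : Finset E) : Set E) ⊆ ω} ⊆ {ω : Set E | Nc[A, P, ω] = A.card} := by
      intro ω hω
      simp only [Set.mem_setOf_eq] at hω ⊢
      rw [Finset.filter_true_of_mem]
      intro a ha y hy
      exact hω (Finset.mem_coe.2 (Finset.mem_biUnion.2 ⟨a, ha, Finset.mem_coe.1 hy⟩))
    have hone : (prodBernoulli q).real {ω : Set E | ((A.biUnion P : Finset E) : Set E) ⊆ ω} = 1 := by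
      rw [prodBernoulli_real_subset]
      exact Finset.prod_eq_one fun y hy => hq1 y hy
    rw [← hone]
    exact measureReal_mono hsub
  by_cases hh : h = A.card
  · rw [if_pos hh, hh]; exact htop
  · rw [if_neg hh]
    rcases Nat.lt_or_gt_of_ne hh with hlt | hgt
    · -- below the top: the remaining mass is `0`
      have hsum := sum_law_eq_one q A P
      rw [Finset.sum_range_succ, htop] at hsum
      have hzero : ∑ k ∈ Finset.range A.card, (prodBernoulli q).real {ω : Set E | Nc[A, P, ω] = k} = 0 := by linarith
      exact (Finset.sum_eq_zero_iff_of_nonneg fun k _ => measureReal_nonneg).1 hzero h (Finset.mem_range.2 hlt)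
    · exact law_eq_zero_of_lt q A P h hgt

/-! ### The count law is SDEC (under `SDECConvClosed`) -/

/-- **THE INDUCTION (SDEC form).**  Under `SDECConvClosed`: for transitive comparable ancestor finsets, every relay set `A` and every
floor `0 < x < 1` with `x ≤ ∏_{y ∈ P a} q y` on `A` (NON-strict: the tight floor is allowed), the law of `N_A` is `LawDec.SDEC x #A`.
Same recursion as `treeBuilt_real_count`: point law (`sdec_point`); GATE (erase the root `r`; floor `x / q r`; if that floor is `1` the
erased system has all marginals `1` and the law is a gated point mass, `sdec_gate_point`); CONVOLUTION (`SDECConvClosed` with the law facts). [this work] -/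
theorem sdec_real_count (hC : LawDec.SDECConvClosed) (q : E → unitInterval) :
    ∀ (n : ℕ) (P : E → Finset E) (A : Finset E), (A.biUnion P).card + A.card ≤ n →
      (∀ x, ∀ y ∈ P x, P y ⊆ P x) → (∀ x, ∀ y ∈ P x, ∀ z ∈ P x, y ∈ P z ∨ z ∈ P y) →
      ∀ x : ℝ, 0 < x → x < 1 → (∀ a ∈ A, x ≤ ∏ y ∈ P a, (q y : ℝ)) →
      LawDec.SDEC x A.card (fun h => (prodBernoulli q).real {ω : Set E | Nc[A, P, ω] = h}) := by
  intro n
  induction n with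
  | zero =>
    intro P A hcard _ _ x hx0 hx1 _
    have hA : A = ∅ := Finset.card_eq_zero.1 (by omega)
    subst hA
    have e : (fun h => (prodBernoulli q).real {ω : Set E | Nc[(∅ : Finset E), P, ω] = h}) =
        fun h => if h = (∅ : Finset E).card then (1 : ℝ) else 0 :=
      funext fun h => real_count_eq_point q ∅ P (fun a ha => absurd ha (Finset.notMem_empty a)) h
    rw [e]; exact LawDec.sdec_point x hx0 hx1.le _
  | succ n ih =>
    intro P A hcard htrans hchain x hx0 hx1 hfloor
    by_cases hU : A.biUnion P = ∅
    · have e : (fun h => (prodBernoulli q).real {ω : Set E | Nc[A, P, ω] = h}) = fun h => if h = A.card then (1 : ℝ) else 0 :=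
        funext fun h => real_count_eq_point q A P
          (fun a ha => Finset.subset_empty.1 (hU ▸ Finset.subset_biUnion_of_mem P ha)) h
      rw [e]; exact LawDec.sdec_point x hx0 hx1.le _
    · obtain ⟨r, hrU, hmin, hroot⟩ := exists_root P htrans A (Finset.nonempty_iff_ne_empty.2 hU)
      have hkey : ∀ y ∈ A.biUnion P, y ∈ P r → r ∈ P y :=
        fun y hyU hy => root_mem_of_mem P htrans A hmin hroot hyU hy
      obtain ⟨a₀, ha₀, hra₀⟩ := Finset.mem_biUnion.1 hrU
      have hqr : (0 : ℝ) < q r := hx0.trans_le ((hfloor a₀ ha₀).trans (prod_coe_le_apply q hra₀))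
      by_cases hall : ∀ a ∈ A, r ∈ P a
      · -- GATE
        have elaw : LawDec.gate (fun i => (prodBernoulli q).real {ω : Set E | Nc[A, (fun y => (P y).erase r), ω] = i}) (q r) =
            fun h => (prodBernoulli q).real {ω : Set E | Nc[A, P, ω] = h} :=
          funext fun h => (real_count_eq_gate q A P r hall h).symm
        have hfloor' : ∀ a ∈ A, x / q r ≤ ∏ y ∈ (P a).erase r, (q y : ℝ) := by
          intro a ha
          have := hfloor a ha
          rw [← Finset.mul_prod_erase (P a) (fun y => (q y : ℝ)) (hall a ha)] at this
          rw [div_le_iff₀ hqr, mul_comm]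
          exact this
        by_cases hx' : x / q r < 1
        · have htrans' : ∀ x, ∀ y ∈ (P x).erase r, (P y).erase r ⊆ (P x).erase r := fun x y hy =>
            Finset.erase_subset_erase r (htrans x y (Finset.mem_of_mem_erase hy))
          have hchain' : ∀ x, ∀ y ∈ (P x).erase r, ∀ z ∈ (P x).erase r, y ∈ (P z).erase r ∨ z ∈ (P y).erase r := by
            intro x y hy z hz
            rcases hchain x y (Finset.mem_of_mem_erase hy) z (Finset.mem_of_mem_erase hz) with h | h
            · exact Or.inl (Finset.mem_erase.2 ⟨Finset.ne_of_mem_erase hy, h⟩)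
            · exact Or.inr (Finset.mem_erase.2 ⟨Finset.ne_of_mem_erase hz, h⟩)
          have hsub : A.biUnion (fun y => (P y).erase r) ⊆ (A.biUnion P).erase r := by
            intro y hy
            obtain ⟨a, ha, hya⟩ := Finset.mem_biUnion.1 hy
            exact Finset.mem_erase.2 ⟨Finset.ne_of_mem_erase hya, Finset.mem_biUnion.2 ⟨a, ha, Finset.mem_of_mem_erase hya⟩⟩
          have hcard' : (A.biUnion (fun y => (P y).erase r)).card + A.card ≤ n := by
            have h1 := Finset.card_le_card hsub
            rw [Finset.card_erase_of_mem hrU] at h1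
            have h2 : 0 < (A.biUnion P).card := Finset.card_pos.2 ⟨r, hrU⟩
            omega
          have hg := LawDec.sdec_gate (ih (fun y => (P y).erase r) A hcard' htrans' hchain' (x / q r) (div_pos hx0 hqr) hx' hfloor')
            (q r : ℝ) hqr (q r).2.2
          have e1 : (q r : ℝ) * (x / q r) = x := by field_simp
          rw [e1, elaw] at hg; exact hg
        · -- the erased system has all marginals `1`: a gated point mass at floor `x = q r`
          have hx1' : x / q r = 1 := le_antisymm ((hfloor' a₀ ha₀).trans
            (Finset.prod_le_one (fun y _ => (q y).2.1) (fun y _ => (q y).2.2))) (not_lt.1 hx')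
          have hxq : x = q r := by
            have := (div_eq_one_iff_eq hqr.ne').1 hx1'
            exact this
          have hone : ∀ a ∈ A, ∏ y ∈ (P a).erase r, (q y : ℝ) = 1 := fun a ha =>
            le_antisymm (Finset.prod_le_one (fun y _ => (q y).2.1) (fun y _ => (q y).2.2)) (hx1' ▸ hfloor' a ha)
          have epoint : (fun i => (prodBernoulli q).real {ω : Set E | Nc[A, (fun y => (P y).erase r), ω] = i}) =
              fun i => if i = A.card then (1 : ℝ) else 0 :=
            funext fun i => real_count_eq_point_of_marginal_one q A (fun y => (P y).erase r) hone i
          have hg := LawDec.sdec_gate_point (q r : ℝ) hqr (q r).2.2 A.card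
          rw [← epoint, elaw, ← hxq] at hg; exact hg
      · -- CONVOLUTION
        obtain ⟨b₀, hb₀, hrb₀⟩ : ∃ b ∈ A, ¬ r ∈ P b := by
          by_contra hcon
          exact hall fun a ha => by_contra fun hra => hcon ⟨a, ha, hra⟩
        have hc1 : (A.filter fun a => r ∈ P a).card < A.card :=
          Finset.card_lt_card (Finset.filter_ssubset.2 ⟨b₀, hb₀, hrb₀⟩)
        have hc2 : (A.filter fun a => ¬ r ∈ P a).card < A.card :=
          Finset.card_lt_card (Finset.filter_ssubset.2 ⟨a₀, ha₀, not_not.2 hra₀⟩)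
        have hu1 : ((A.filter fun a => r ∈ P a).biUnion P).card ≤ (A.biUnion P).card :=
          Finset.card_le_card (Finset.biUnion_subset_biUnion_of_subset_left P (Finset.filter_subset _ A))
        have hu2 : ((A.filter fun a => ¬ r ∈ P a).biUnion P).card ≤ (A.biUnion P).card :=
          Finset.card_le_card (Finset.biUnion_subset_biUnion_of_subset_left P (Finset.filter_subset _ A))
        have ih₁ := ih P (A.filter fun a => r ∈ P a) (by omega) htrans hchain x hx0 hx1
          (fun a ha => hfloor a (Finset.mem_filter.1 ha).1)
        have ih₂ := ih P (A.filter fun a => ¬ r ∈ P a) (by omega) htrans hchain x hx0 hx1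
          (fun a ha => hfloor a (Finset.mem_filter.1 ha).1)
        have htop : ∀ B : Finset E, (∀ a ∈ B, x ≤ ∏ y ∈ P a, (q y : ℝ)) →
            x * (B.card : ℝ) ≤ ∑ h ∈ Finset.range (B.card + 1), (h : ℝ) * (prodBernoulli q).real {ω : Set E | Nc[B, P, ω] = h} := by
          intro B hB
          rw [sum_mul_law_eq]
          exact floor_mul_card_le_sum q B P x hB
        have hc := hC x (A.filter fun a => r ∈ P a).card (A.filter fun a => ¬ r ∈ P a).card
          (fun i => (prodBernoulli q).real {ω : Set E | Nc[A.filter (fun a => r ∈ P a), P, ω] = i})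
          (fun i => (prodBernoulli q).real {ω : Set E | Nc[A.filter (fun a => ¬ r ∈ P a), P, ω] = i})
          hx0 hx1 (fun h => measureReal_nonneg) (fun h hh => law_eq_zero_of_lt q _ P h hh) (sum_law_eq_one q _ P)
          (htop _ fun a ha => hfloor a (Finset.mem_filter.1 ha).1)
          (fun h => measureReal_nonneg) (fun h hh => law_eq_zero_of_lt q _ P h hh) (sum_law_eq_one q _ P)
          (htop _ fun a ha => hfloor a (Finset.mem_filter.1 ha).1) ih₁ ih₂
        have e1 : (A.filter fun a => r ∈ P a).card + (A.filter fun a => ¬ r ∈ P a).card = A.card :=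
          Finset.card_filter_add_card_filter_not _
        have e2 : LawDec.lconv (A.filter fun a => r ∈ P a).card (A.filter fun a => ¬ r ∈ P a).card
            (fun i => (prodBernoulli q).real {ω : Set E | Nc[A.filter (fun a => r ∈ P a), P, ω] = i})
            (fun i => (prodBernoulli q).real {ω : Set E | Nc[A.filter (fun a => ¬ r ∈ P a), P, ω] = i}) =
            fun h => (prodBernoulli q).real {ω : Set E | Nc[A, P, ω] = h} :=
          funext fun h => (real_count_eq_lconv q A P r (disjoint_biUnion_root P htrans hchain A r hkey) h).symm
        rw [e1, e2] at hc; exact hc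

/-- **The count law of a rooted forest is SDEC (under `SDECConvClosed`)**: transitive comparable ancestor finsets, `0 < x < 1`,
`x ≤ ∏_{y ∈ P a} q y` on `A` ⟹ `LawDec.SDEC x #A (law of N_A)`. [this work] -/
theorem sdec_law (hC : LawDec.SDECConvClosed) (q : E → unitInterval) (P : E → Finset E) (htrans : ∀ x, ∀ y ∈ P x, P y ⊆ P x)
    (hchain : ∀ x, ∀ y ∈ P x, ∀ z ∈ P x, y ∈ P z ∨ z ∈ P y) (A : Finset E) (x : ℝ) (hx0 : 0 < x) (hx1 : x < 1)
    (hfloor : ∀ a ∈ A, x ≤ ∏ y ∈ P a, (q y : ℝ)) :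
    LawDec.SDEC x A.card (fun h => (prodBernoulli q).real {ω : Set E | Nc[A, P, ω] = h}) :=
  sdec_real_count hC q _ P A le_rfl htrans hchain x hx0 hx1 hfloor

/-- **DEC at every layer and every floor `x < 1` with `x ≤` every marginal (under `SDECConvClosed`)**: floors `≤ 0` by
`decAt_of_floor_nonpos`, floors in `(0,1)` by `sdec_law` + `decAt_of_sdec`. [this work] -/
theorem decAt_law (hC : LawDec.SDECConvClosed) (q : E → unitInterval) (P : E → Finset E) (htrans : ∀ x, ∀ y ∈ P x, P y ⊆ P x)
    (hchain : ∀ x, ∀ y ∈ P x, ∀ z ∈ P x, y ∈ P z ∨ z ∈ P y) (A : Finset E) (x : ℝ) (hx1 : x < 1)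
    (hfloor : ∀ a ∈ A, x ≤ ∏ y ∈ P a, (q y : ℝ)) (j' : ℕ) :
    LawDec.DECAt x j' A.card (fun h => (prodBernoulli q).real {ω : Set E | Nc[A, P, ω] = h}) := by
  by_cases hx0 : 0 < x
  · refine LawDec.decAt_of_sdec (sdec_law hC q P htrans hchain A x hx0 hx1 hfloor) hx0 hx1 (fun h => measureReal_nonneg)
      (fun h hh => law_eq_zero_of_lt q A P h hh) (sum_law_eq_one q A P) ?_ j'
    rw [sum_mul_law_eq]
    exact floor_mul_card_le_sum q A P x hfloor
  · exact LawDec.decAt_of_floor_nonpos A.card _ (fun h => measureReal_nonneg) (fun h hh => law_eq_zero_of_lt q A P h hh)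
      (sum_law_eq_one q A P) x (not_lt.1 hx0) j'

end ForestLaw

/-! ### `SDECConvClosed ⟹ TreeDEC` -/

section Bridge

open Finset MeasureTheory
open Literature.Probability.LatticeModels
open Literature.Probability.Percolation
open scoped Classical

/-- **`LawDec.SDECConvClosed ⟹ Quant.TreeDEC`** — census-2 g53's law-level closure conjecture implies the lane's typed finite-layer
conjecture T-DEC for every rooted forest, AT the tight floor `1 − t` and at EVERY layer (the hypothesis `E N ≤ 2j′` is not used).
Floor `1 − t < 1`: `ForestLaw.decAt_law`; floor `1 − t ≥ 1`: every marginal is `1`, the law is the point mass `δ_{#A}` (`decAt_point`).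
CONDITIONAL result: `SDECConvClosed` and `TreeDEC` are OPEN. [this work] -/
theorem treeDEC_of_sdecConvClosed (hC : LawDec.SDECConvClosed) : TreeDEC := by
  intro m P _ htrans hchain q A t j' hmarg _
  have hfloor : ∀ a ∈ A, 1 - t ≤ ∏ y ∈ P a, (q y : ℝ) := fun a ha => by linarith [hmarg a ha]
  by_cases ht : 1 - t < 1
  · exact ForestLaw.decAt_law hC q P htrans hchain A (1 - t) ht hfloor j'
  · -- every marginal is `1`
    have hone : ∀ a ∈ A, ∏ y ∈ P a, (q y : ℝ) = 1 := fun a ha =>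
      le_antisymm (Finset.prod_le_one (fun y _ => (q y).2.1) (fun y _ => (q y).2.2)) ((not_lt.1 ht).trans (hfloor a ha))
    have e : (fun h => (prodBernoulli q).real
        {ω : Set (Fin m) | (A.filter fun a => ((P a : Finset (Fin m)) : Set (Fin m)) ⊆ ω).card = h}) =
        fun h => if h = A.card then (1 : ℝ) else 0 :=
      funext fun h => ForestLaw.real_count_eq_point_of_marginal_one q A P hone h
    rw [e]
    exact LawDec.decAt_point (1 - t) j' A.card

end Bridge

end Quant

end Summit.CriticalPhenomena.PercolationContinuityZ3.Theorems
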